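import Summits.AnomalousDissipation.AnomalousDissipation.Theses.TaylorCertificates
import Summits.AnomalousDissipation.AnomalousDissipation.Theorems.TaylorCertificatePair.Negative.Modes
import Literature.Analysis.FunctionSpaces.TorusFluidGlueProofs
import Literature.Analysis.FunctionSpaces.TorusLerayHelmholtzProofs
import Literature.Analysis.FunctionSpaces.TorusCalculusProofs
import Literature.Analysis.FunctionSpaces.TorusTestFunction

/-!
# Stub `stub_strongForm` of the line `Sketch` (helical path) for the crux
# `TaylorCertificates.SmoothEulerCoerciveForce` (stmt-AnomalousDissipation-14097)

Weak ⇒ strong form of the steady forced Euler equations on `T³` with a SMOOTH pressure, for a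
general smooth mean-zero force `f`: if `v` is smooth and divergence free and
`∫ ⟪(v·∇)v − f, w⟫ = 0` for every smooth divergence-free mean-zero test field `w`, then
`(v·∇)v + ∇p = f` pointwise for some smooth `p : T³ → ℝ` (`stub_strongForm`, the registered stub of
the skeleton `work/SmoothEulerCoerciveForce.lean` of line lead
`prover-line-stmt-AnomalousDissipation-14097-0`).

Proof (standard; de Rham on the torus via the smooth Helmholtz–Weyl decomposition,
Robinson–Rodrigo–Sadowski 2016, Thm. 2.6). Write `g := f − (v·∇)v = w₀ + ∇φ₀` with `w₀` smooth
divergence free and `φ₀` smooth (`Torus.smooth_helmholtz_holds`). Testing the weak identity with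
`w := w₀ − c`, `c := ∫ w₀` (smooth, divergence free, mean zero), gives
`0 = ∫ ⟪w₀ + ∇φ₀, w₀ − c⟫ = ∫ ‖w₀ − c‖² + ⟪c, ∫ (w₀ − c)⟫ + ∫ ⟪∇φ₀, w₀ − c⟫ = ∫ ‖w₀ − c‖²`
(`∫ ⟪∇φ₀, u⟫ = 0` for smooth divergence-free `u`, `Torus.integral_inner_gradient_eq_zero_of_isDivFree`),
so `w₀ ≡ c` by continuity. Taking means in `g = w₀ + ∇φ₀`: `∫ g = ∫ f − ∫ (v·∇)v = 0 − 0`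
(`∫ Dv[v] = 0` for divergence-free `v`, `Torus.integral_fderiv_apply_eq_zero_of_isDivFree`) while
`∫ (w₀ + ∇φ₀) = ∫ w₀ = c` (`Torus.integral_add_gradient`); hence `c = 0`, `g = ∇φ₀`, and `p := φ₀`
works. NOT here: anything specific to the helical force, uniqueness of the pressure, the other
stubs of the line.
-/

-- `Summit.<Summit>.<Problem>` is the tree's mandated summit-side namespace (CONVENTIONS §2); for this
-- single-conjunct summit the two coincide, so the duplicate is deliberate.
set_option linter.dupNamespace false

noncomputable section

open MeasureTheory
open scoped InnerProductSpace

namespace Summit.AnomalousDissipation.AnomalousDissipation.Theorems.SmoothEulerCoerciveForce.Helical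

open Literature.Analysis.FunctionSpaces
open Summit.AnomalousDissipation.AnomalousDissipation.Theses.TaylorCertificates
open Summit.AnomalousDissipation.AnomalousDissipation.Theorems.TaylorCertificatePair.Negative

/-! ## Helpers: constant shifts of divergence-free fields, vanishing of `L²`-null smooth fields -/

-- adapted from Summits/AnomalousDissipation/AnomalousDissipation/Cruxes/SmoothEulerCoerciveForce/Disproof.lean
-- (`divergence_const`, `crux_iff_smooth_force`)
/-- The divergence of a constant vector field on `T³` vanishes. [folklore] -/
theorem strongForm_divergence_const (c : EuclideanSpace ℝ (Fin 3)) (x : UnitAddTorus (Fin 3)) :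
    Torus.divergence (fun _ : UnitAddTorus (Fin 3) => c) x = 0 := by
  simp [Torus.divergence, Torus.partialDeriv, Torus.lineDeriv]

/-- A smooth divergence-free field on `T³` minus a constant vector is divergence free
(`Torus.divergence_sub`). [folklore] -/
theorem strongForm_isDivFree_sub_const {w : UnitAddTorus (Fin 3) → EuclideanSpace ℝ (Fin 3)}
    (hw : Torus.IsSmooth w) (hdiv : Torus.IsDivFree w) (c : EuclideanSpace ℝ (Fin 3)) :
    Torus.IsDivFree (fun x => w x - c) := fun x => by
  have h1 : Torus.IsContDiff 1 w := hw.isContDiff (by simp)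
  have h2 : Torus.IsContDiff 1 (fun _ : UnitAddTorus (Fin 3) => c) :=
    (Torus.isSmooth_const c).isContDiff (by simp)
  have h := Torus.divergence_sub h1 h2 x
  rw [show (w - fun _ => c) = fun x => w x - c from rfl] at h
  rw [h, hdiv x, strongForm_divergence_const, sub_zero]

/-- A smooth field on `T³` minus its mean has zero mean (the torus carries a probability
measure). [folklore] -/
theorem strongForm_hasZeroMean_sub_integral {w : UnitAddTorus (Fin 3) → EuclideanSpace ℝ (Fin 3)}
    (hw : Torus.IsSmooth w) : Torus.HasZeroMean (fun x => w x - ∫ y, w y) := by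
  unfold Torus.HasZeroMean
  rw [integral_sub hw.integrable (integrable_const _), integral_const]
  simp

-- adapted from Literature/Analysis/FunctionSpaces/TorusLerayHelmholtz.lean (`gradient_eq_zero_of_isDivFree`)
/-- A smooth field on `T³` whose squared norm has integral zero vanishes identically (the
integrand is continuous and nonnegative, so a.e. zero means everywhere zero). [folklore] -/
theorem strongForm_eq_zero_of_integral_norm_sq_eq_zero
    {u : UnitAddTorus (Fin 3) → EuclideanSpace ℝ (Fin 3)} (hu : Torus.IsSmooth u)
    (h0 : ∫ x, ‖u x‖ ^ 2 = 0) (x : UnitAddTorus (Fin 3)) : u x = 0 := by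
  have hae : (fun x => ‖u x‖ ^ 2) =ᵐ[volume] 0 :=
    (integral_eq_zero_iff_of_nonneg (f := fun x => ‖u x‖ ^ 2) (fun x => sq_nonneg _)
      hu.norm_sq.integrable).1 h0
  have heq : (fun x => ‖u x‖ ^ 2) = 0 :=
    (Continuous.ae_eq_iff_eq volume (hu.continuous.norm.pow 2) continuous_const).1 hae
  have hx := congrFun heq x
  simp only [Pi.zero_apply, ne_eq, OfNat.ofNat_ne_zero, not_false_eq_true, pow_eq_zero_iff,
    norm_eq_zero] at hx
  exact hx

/-! ## The stub -/

/-- **Stub 2 of line `Sketch` (strong form with smooth pressure, general force).** A smooth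
divergence-free quiet Euler point `v` of a smooth mean-zero force `f` on `T³` — i.e.
`∫ ⟪(v·∇)v − f, w⟫ = 0` for all smooth divergence-free mean-zero `w` — solves `(v·∇)v + ∇p = f`
pointwise for a smooth pressure `p`. Proof: smooth Helmholtz decomposition
`f − (v·∇)v = w₀ + ∇φ₀` (`Torus.smooth_helmholtz_holds`, Robinson–Rodrigo–Sadowski 2016, Thm. 2.6);
testing against `w₀ − ∫ w₀` shows the solenoidal part `w₀` is constant, and the constant is `0`
because `(v·∇)v` (`div v = 0`) and `f` have zero mean while gradients integrate to zero; `p := φ₀`. [folklore] -/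
theorem stub_strongForm
    (f v : UnitAddTorus (Fin 3) → EuclideanSpace ℝ (Fin 3))
    (hf : Torus.IsSmooth f) (hfz : Torus.HasZeroMean f)
    (hvs : Torus.IsSmooth v) (hvd : Torus.IsDivFree v)
    (hq : ∀ w : UnitAddTorus (Fin 3) → EuclideanSpace ℝ (Fin 3), Torus.IsSmooth w → Torus.IsDivFree w →
      Torus.HasZeroMean w → ∫ x, inner ℝ (Torus.convect v v x - f x) (w x) = 0) :
    ∃ p : UnitAddTorus (Fin 3) → ℝ, Torus.IsSmooth p ∧
      ∀ x, Torus.convect v v x + Torus.gradient p x = f x := by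
  -- smooth Helmholtz decomposition of `g := f - (v·∇)v`
  have hcs : Torus.IsSmooth (Torus.convect v v) := hvs.convect hvs
  have hg : Torus.IsSmooth (fun x => f x - Torus.convect v v x) := hf.sub hcs
  obtain ⟨w₀, φ₀, hw₀, hφ₀, hdiv, -, hdec⟩ :=
    Torus.smooth_helmholtz_holds (d := Fin 3) (fun x => f x - Torus.convect v v x) hg
  have hdec' : ∀ x, f x - Torus.convect v v x = w₀ x + Torus.gradient φ₀ x := hdec
  -- test the weak identity with `w₀ - ∫ w₀`
  set c : EuclideanSpace ℝ (Fin 3) := ∫ y, w₀ y with hc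
  have hws : Torus.IsSmooth (fun x => w₀ x - c) := hw₀.sub (Torus.isSmooth_const c)
  have hwd : Torus.IsDivFree (fun x => w₀ x - c) := strongForm_isDivFree_sub_const hw₀ hdiv c
  have hwz : Torus.HasZeroMean (fun x => w₀ x - c) := strongForm_hasZeroMean_sub_integral hw₀
  have h0 := hq _ hws hwd hwz
  have hpt : ∀ x, ⟪Torus.convect v v x - f x, w₀ x - c⟫_ℝ =
      -(⟪w₀ x - c, w₀ x - c⟫_ℝ + ⟪c, w₀ x - c⟫_ℝ + ⟪Torus.gradient φ₀ x, w₀ x - c⟫_ℝ) := by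
    intro x
    have e : Torus.convect v v x - f x = -((w₀ x - c) + c + Torus.gradient φ₀ x) := by
      rw [sub_add_cancel, ← hdec' x, neg_sub]
    rw [e, inner_neg_left, inner_add_left, inner_add_left]
  simp_rw [hpt] at h0
  have i1 : Integrable (fun x => ⟪w₀ x - c, w₀ x - c⟫_ℝ) volume := (hws.inner hws).integrable
  have i2 : Integrable (fun x => ⟪c, w₀ x - c⟫_ℝ) volume :=
    ((Torus.isSmooth_const c).inner hws).integrable
  have i12 : Integrable (fun x => ⟪w₀ x - c, w₀ x - c⟫_ℝ + ⟪c, w₀ x - c⟫_ℝ) volume := i1.add i2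
  have i3 : Integrable (fun x => ⟪Torus.gradient φ₀ x, w₀ x - c⟫_ℝ) volume :=
    (hφ₀.gradient.inner hws).integrable
  have hgrad : ∫ x, ⟪Torus.gradient φ₀ x, w₀ x - c⟫_ℝ = 0 :=
    Torus.integral_inner_gradient_eq_zero_of_isDivFree hws hφ₀ hwd
  have hmean : ∫ x, ⟪c, w₀ x - c⟫_ℝ = 0 := by
    have hwz' : ∫ x, (w₀ x - c) = 0 := hwz
    rw [integral_inner hws.integrable c, hwz', inner_zero_right]
  rw [integral_neg, neg_eq_zero, integral_add i12 i3, integral_add i1 i2, hgrad, hmean, add_zero,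
    add_zero] at h0
  simp_rw [real_inner_self_eq_norm_sq] at h0
  -- hence `w₀ ≡ c`
  have hw0 : ∀ x, w₀ x = c := fun x =>
    sub_eq_zero.1 (strongForm_eq_zero_of_integral_norm_sq_eq_zero hws h0 x)
  -- and `c = 0` by taking means: `∫ (f - (v·∇)v) = 0 - 0`, `∫ (w₀ + ∇φ₀) = ∫ w₀ = c`
  have hconv : ∫ x, Torus.convect v v x = 0 :=
    Torus.integral_fderiv_apply_eq_zero_of_isDivFree hvs hvs hvd
  have hc0 : c = 0 := by
    have h1 : ∫ x, (f x - Torus.convect v v x) = 0 := by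
      rw [integral_sub hf.integrable hcs.integrable, hconv, sub_zero]
      exact hfz
    rw [show (fun x => f x - Torus.convect v v x) = fun x => w₀ x + Torus.gradient φ₀ x from
        funext hdec', Torus.integral_add_gradient hw₀ hφ₀] at h1
    rw [hc]
    exact h1
  -- conclusion: `f - (v·∇)v = ∇φ₀`
  refine ⟨φ₀, hφ₀, fun x => ?_⟩
  have hx := hdec' x
  rw [hw0 x, hc0, zero_add] at hx
  rw [← hx]
  abel

end Summit.AnomalousDissipation.AnomalousDissipation.Theorems.SmoothEulerCoerciveForce.Helical

end
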